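import Mathlib
import Literature.MathematicalPhysics.QuantumFieldTheory.Balaban1983to89.B4Sect5Proof

/-!
# The Sect. 5 Theorem of B4 on an ARBITRARY (possibly infinite) `Ω ⊂ ℤ^d` — the Dirichlet exhaustion, kernel-proved

T. Bałaban, *Regularity and decay of lattice Green's functions*, Commun. Math. Phys. **89** (1983) 571–597
[Balaban1983RegularityDecay] (= B4 of the series), Sect. 5 Theorem p. 594 (journal page = PDF page + 570; ×2 renders
`run/shared/lean/pub/pub-balaban/b2b-balaban-ref1/pages/1983-cmp89-regularity-decay/…-p024-x2.png`, `…-p026-x2.png`,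
`…-p027-x2.png`; cell transcript `b2b-balaban-b04/transcript-B4.md` ll. 329–349, 372–399).
Unit b2b-balaban-pv23-g7 (surge node prover #23, gen 7, cell pub-balaban; journal claim B4-SECT5-EXHAUSTION = KERNEL
self-row under the LEMMAS.md yield clause naming T01.4 / PHASE-2 row B4; GAPS row C-pv23g7-2).  Single tree import:
`…B4Sect5Proof` (this unit's gen-3 module, [ACCEPTED] p179258); nothing landed is edited.

VALUE = the kernel discharge of the printed theorem's FULL `Ω`-SCOPE.  The paper says *"Let Ω ⊂ Z^d"* — any subset —
while the tree leaf `B4.Sect5ThmUniform d N` (typed by unit b04, D-b04.5; PROVED in `…B4Sect5Proof`) quantifies over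
FINITE `Ω` only, and `…B4Sect5Proof`'s header records *"it proves no torus / infinite-Ω version"*; the cell's wall
ledger (`BETA/WALL.md` §9, row "B4 Sect. 5 Theorem") lists *"infinite-Ω passage (uniformity + limit)"* as dictionary
still owed.  This file supplies that passage as theorems: uniformity is `…B4Sect5Proof.sect5_explicit` (constants
`cStar, deltaStar` independent of `Ω`), the limit is the Dirichlet exhaustion `Ω ∩ [−n,n]^d ↗ Ω` controlled by (5.8)
itself.  (The torus version is the separate module `…B4Sect5Torus`, unit pv09-g4.)  NOT summit progress.

## What is printed (verbatim)

p. 594 [PDF 24]: *"Theorem. Let Ω ⊂ Z^d and let A be a symmetric operator defined on the space L²(Ω) of functions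
φ : Ω → R^N and satisfying the following condition: there exist positive constants γ₀, c₀, δ₀ such that
A ≥ γ₀I, |A(x, x′)| ≤ c₀e^{−δ₀|x−x′|}, x, x′ ∈ Ω. (5.6)
Then there exist positive constants c₁, δ₁ such that for arbitrary Λ ⊂ Ω and for C_Λ = A_Λ^{−1}, A_Λ is an operator
defined on L²(Λ) by A_Λ = ΛAΛ. We have
|C_Λ(x, x′)| ≤ c₁e^{−δ₁|x−x′|}, x, x′ ∈ Λ, (5.7)
|δC_Λ(x, x′)| ≤ c₁e^{−δ₁(|x−x′| + dist(x, Λ^c) + dist(x′, Λ^c))}, δC_Λ = C_Λ − C_Ω. (5.8)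
If we perturb the operator A by an operator B such that the condition (5.6) is satisfied for A + B, and additionally
B has the property
|B(x, x′)| ≤ c₀e^{−δ₀(|x−x′| + dist(x, Ω^c) + dist(x′, Ω^c))}, x, x′ ∈ Ω, (5.9)
then we have also
|A_Λ^{−1}(x, x′) − (A + B)_Λ^{−1}(x, x′)| ≤ c₁e^{−δ₁(|x−x′| + dist(x, Ω^c) + dist(x′, Ω^c))}, x, x′ ∈ Λ. (5.10)"*
p. 596 [PDF 26]: *"If □′_j is disjoint with the complement Λ^c of Λ in Ω, then □′_j = □_j and C′_j = C_j."*
p. 597 [PDF 27]: *"Thus Inequality (5.10) is proved. The constants δ₁, c₁ are functions of δ₀, γ₀, c₀, and from the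
above proof we can get more precise estimates for them."*

## Dictionary (typist's readings — flagged, D-pv23g7.1)

(α) "a symmetric operator A on L²(Ω)", `Ω ⊂ ℤ^d` arbitrary ↦ a KERNEL `A : K d N → K d N → ℝ` on the ambient index set
`K d N = ℤ^d × Fin N` of which only the values at indices over `Ω` are ever read; "A ≥ γ₀I" ↦ the quadratic-form bound
`γ₀‖v‖² ≤ ⟨v, A_Λv⟩` on finitely supported `v` (every finite `Λ ⊆ Ω`), i.e. B4's `Hyp56` for every finite `A_Λ`
(`Hyp56Z`, `Hyp56Z.hyp56`); for a finite `Ω` this IS `B4.Hyp56 Ω A_Ω` (`Hyp56Z.of_hyp56`, via `B6GOmega.hyp56_compress`).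
(β) "`C_Λ = A_Λ^{−1}`" for an infinite `Λ` ↦ `limInv Λ A`, the entrywise limit of the finite Dirichlet inverses
`(A_{Λ ∩ [−n,n]^d})⁻¹` — PROVED here to exist (`tendsto_limInv`), to be a two-sided inverse of `A_Λ = ΛAΛ` with
absolutely convergent sums (`tsum_mul_limInv`, `tsum_limInv_mul`, `summable_mul_limInv`), symmetric (`limInv_symm`),
and to be the ONLY entrywise-bounded inverse kernel (`eq_limInv_of_left_inverse` / `…_right_inverse`), so the reading
is forced among bounded kernels; for a finite `Λ` it is literally B4's matrix inverse (`limInv_coe_finset`,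
`inv_toMat_apply`, `compress_toMat`).  No `ℓ²`-operator layer is built (HONEST SCOPE below).
(γ) `Λ^c = Ω ∖ Λ` (p. 596 quoted above), `Ω^c = ℤ^d ∖ Ω`, `|x − x′|` = the sup-distance of `Fin d → ℤ`, entrywise
bounds — exactly as typed in `…B4` (D-b04.5/6: `B4.Concl57_58`, `B4.Hyp59`, `B4.Concl510`).
(δ) `dist(x, ∅)`: Mathlib's `Metric.infDist x ∅ = 0`, the printed infimum over `∅` is `+∞`.  This matters only for
(5.9)/(5.10) when `Ω = ℤ^d`: there the printed (5.9) forces `B = 0` and (5.10) is void, whereas with `infDist` it would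
be a different (weaker-hypothesis) statement; the infinite-volume (5.10) is therefore stated for `Ω ≠ ℤ^d`
(`Ωᶜ.Nonempty`).  (5.7)/(5.8) are unaffected (`Ω ∖ Λ = ∅` means `Λ = Ω`, where `δC_Ω = 0`).

## The route (an exhaustion argument on top of the finite theorem; NOT the printed random-walk proof)

* §5: (5.7) and (5.8) with the `Ω`-independent constants `(c⋆, δ⋆) = (cStar, deltaStar)` on every pair of FINITE sets
  `Λ ⊆ Ω' ⊆ Ω`, BY NAME from `…B4Sect5Proof.sect5_explicit` (`finInv_abs_le`, `finInv_sub_finInv_abs_le`).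
* §6: along the cubes `Ω_n = Ω ∩ [−n,n]^d`, (5.8) for `Ω_n ⊆ Ω_m` gives `|C_{Ω_n}(x,x′) − C_{Ω_m}(x,x′)| ≤
  c⋆e^{−δ⋆(n+1−R)}` for `x, x′ ∈ [−R,R]^d`, because every point of `Ω_m ∖ Ω_n` lies outside `[−n,n]^d`
  (`finInv_cut_dist_le`); the entries are Cauchy (`cauchySeq_finInv_cut`), `ℝ` is complete: `C_Ω := lim` (`limInv`).
* §7: (5.8) for an arbitrary pair `Λ ⊆ Ω` by passing to the limit in (5.8) for `Λ_n ⊆ Ω_n` (`Ω_n ∖ Λ_n ⊆ Ω ∖ Λ`);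
  (5.7) likewise (`limInv_abs_le`, §6).
* §8: `Σ_y A(x,y)C_Ω(y,x′) = δ_{xx′}` by Tannery's theorem (`tendsto_tsum_of_dominated_convergence`) applied to the
  eventually constant sequence of finite identities `A_{Ω_n}A_{Ω_n}⁻¹ = I`, with the summable majorant
  `c₀c⋆e^{−δ₀|x−y|}` (uniform lattice sums, `…B4Sect5Proof.latticeSum_le`); the left identity from the symmetry of
  `A` and of `C_Ω` (`Matrix.transpose_nonsing_inv`).
* §9: uniqueness by Fubini (`Summable.tsum_comm`) on the absolutely summable triple product `D(x,y)A(y,z)C_Ω(z,x′)`.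
* §10: (5.10) by passing to the limit in the finite (5.10) for `Λ_n ⊆ Ω_n` ((5.9) on `Ω` gives B4's `Hyp59` on every
  finite `Ω_n ⊆ Ω ≠ ℤ^d`), using `min(dist(x, Ω^c), n+1−R) ≤ dist(x, Ω_n^c)` (`min_le_infDist_compl_cut`).

## What is kernel-checked here (0 sorry; axioms propext / Classical.choice / Quot.sound only)

§1 `toMat`, `compress_toMat`, `finInv`, `inv_toMat_apply`; §2 `Hyp56Z` (+ `mono`, `hyp56`, `of_hyp56`); §3 `cube`,
`rad`, `cut` (+ lemmas), `dist_ge_of_not_mem_box`, `le_infDist_of_disjoint_box`; §4 `sum_expKernel_le`,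
`summable_expKernel`, `tsum_expKernel_le`; §5 `finInv_abs_le`, `finInv_abs_le_cStar`, `finInv_sub_finInv_abs_le`;
§6 `finInv_cut_dist_le`, `cauchySeq_finInv_cut`, `limInv`, `tendsto_limInv`, `limInv_of_not_mem`, `limInv_coe_finset`,
`limInv_abs_le` ((5.7)∞), `finInv_symm`, `limInv_symm`; §7 `finInv_cut_sub_cut_abs_le`, **`limInv_sub_limInv_abs_le`**
((5.8)∞ for every `Λ ⊆ Ω`), `inv_toMat_sub_limInv_abs_le` (finite `Λ`, B4's literal objects), `finInv_sub_limInv_abs_le`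
(exhaustion independence); §8 `tsum_mul_finInv`, `abs_mul_finInv_le`, **`tsum_mul_limInv`**, `summable_mul_limInv`,
**`tsum_limInv_mul`**, `summable_limInv_mul`; §9 `sum_expKernel2_le`, **`eq_limInv_of_left_inverse`**,
`eq_limInv_of_right_inverse`; §10 `Hyp59Z` (+ `hyp59`), `infDist_compl_le_of_subset`, `min_le_infDist_compl_cut`,
`finInv_cut_perturb_abs_le`, **`limInv_perturb_abs_le`** ((5.10)∞); §11 `Sect5ThmSetOmega d N` and
**`sect5ThmSetOmega_holds : ∀ d N, Sect5ThmSetOmega d N`**, non-vacuity `hyp56Z_one` (the identity kernel on `Ω = ℤ^d`).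

## Honest scope / what this does NOT do

* No `ℓ²(Ω; ℝ^N)` bounded-operator formulation is built: "operator", "≥ γ₀I" and "A_Λ^{−1}" are read as kernel
  statements ((α)/(β) above).  What the series consumes from this theorem are the entrywise bounds (5.7)–(5.10), which
  are kernel statements; the identification of `limInv Λ A` with the inverse of the `ℓ²(Λ)`-operator `ΛAΛ` (which exists
  by `A_Λ ≥ γ₀I` and Lax–Milgram) is the routine remark that both are bounded inverse kernels, and bounded inverse
  kernels are unique (§9) — it is NOT typed here.
* It does not certify the printed random-walk proof (5.11)–(5.27); it re-derives the infinite-volume statement from the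
  finite one.  It proves nothing about tori (`…B4Sect5Torus`), rewires no consumer, and asserts nothing of B4 as a fact:
  every hypothesis of every theorem below is (5.6)/(5.9) in kernel form plus `0 < γ₀, c₀, δ₀`; the non-Mathlib inputs
  are the sorry-free tree theorems `…B4Sect5Proof.{sect5_explicit, isUnit_of_hyp56, latticeSum_le, latticeConst_nonneg,
  cStar_pos, deltaStar_pos}`, `…B6GOmega.hyp56_compress`, and the DEFINITIONS `B4.{Idx, compress, Hyp56, Concl57_58,
  Hyp59, Concl510}` (ABSOLUTE-RULE census: no programme-internal statement enters).
-/

namespace Literature.MathematicalPhysics.QuantumFieldTheory.Balaban1983to89.B4Sect5Exhaustion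

open Finset Real Matrix Filter Topology
open B4Sect5Proof (cStar deltaStar latticeConst latticeSum_le sect5_explicit cStar_pos deltaStar_pos)

/-! ## §1  Ambient indices, restriction to a finite `Λ`, zero-extended finite-volume inverse kernels -/

/-- The ambient index set of `L²(ℤ^d; ℝ^N)`: a lattice point and a component. [folklore] -/
abbrev K (d N : ℕ) : Type := (Fin d → ℤ) × Fin N

variable {d N : ℕ}

/-- The restriction `A_Λ = ΛAΛ` (p. 594) of an ambient kernel `A` to a finite `Λ ⊂ ℤ^d`, as a matrix on B4's
index set `B4.Idx Λ N = Λ × Fin N`. [cite: Balaban1983RegularityDecay, Sect. 5 Theorem p.594] -/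
def toMat (Λ : Finset (Fin d → ℤ)) (A : K d N → K d N → ℝ) : Matrix (B4.Idx Λ N) (B4.Idx Λ N) ℝ :=
  fun p q => A ((p.1 : Fin d → ℤ), p.2) ((q.1 : Fin d → ℤ), q.2)

/-- Restriction is compatible with B4's compression: `(A_{Ω'})_Λ = A_Λ` for `Λ ⊆ Ω'`. [folklore] -/
theorem compress_toMat {Ω' Λ : Finset (Fin d → ℤ)} (h : Λ ⊆ Ω') (A : K d N → K d N → ℝ) :
    B4.compress h (toMat Ω' A) = toMat Λ A := rfl

/-- The finite-volume inverse kernel `C_Λ = A_Λ⁻¹` (p. 594), extended by zero to the ambient index set.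
[cite: Balaban1983RegularityDecay, Sect. 5 Theorem p.594] -/
noncomputable def finInv (Λ : Finset (Fin d → ℤ)) (A : K d N → K d N → ℝ) : K d N → K d N → ℝ :=
  fun p q => if h : p.1 ∈ Λ ∧ q.1 ∈ Λ then (toMat Λ A)⁻¹ (⟨p.1, h.1⟩, p.2) (⟨q.1, h.2⟩, q.2) else 0

/-- Inside `Λ` the zero-extended kernel is the matrix entry of `A_Λ⁻¹`. [folklore] -/
theorem finInv_of_mem {Λ : Finset (Fin d → ℤ)} (A : K d N → K d N → ℝ) {p q : K d N}
    (hp : p.1 ∈ Λ) (hq : q.1 ∈ Λ) :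
    finInv Λ A p q = (toMat Λ A)⁻¹ (⟨p.1, hp⟩, p.2) (⟨q.1, hq⟩, q.2) := by
  simp [finInv, hp, hq]

/-- `C_Λ` vanishes when its first index lies outside `Λ`. [folklore] -/
theorem finInv_of_not_mem_left {Λ : Finset (Fin d → ℤ)} (A : K d N → K d N → ℝ) {p q : K d N}
    (hp : p.1 ∉ Λ) : finInv Λ A p q = 0 := by
  simp [finInv, hp]

/-- `C_Λ` vanishes when its second index lies outside `Λ`. [folklore] -/
theorem finInv_of_not_mem_right {Λ : Finset (Fin d → ℤ)} (A : K d N → K d N → ℝ) {p q : K d N}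
    (hq : q.1 ∉ Λ) : finInv Λ A p q = 0 := by
  simp [finInv, hq]

/-- The matrix entry of `A_Λ⁻¹` at B4 indices is the zero-extended kernel at the underlying ambient indices.
[folklore] -/
theorem inv_toMat_apply (Λ : Finset (Fin d → ℤ)) (A : K d N → K d N → ℝ) (p' q' : B4.Idx Λ N) :
    (toMat Λ A)⁻¹ p' q' = finInv Λ A ((p'.1 : Fin d → ℤ), p'.2) ((q'.1 : Fin d → ℤ), q'.2) := by
  rw [finInv_of_mem A (p := ((p'.1 : Fin d → ℤ), p'.2)) (q := ((q'.1 : Fin d → ℤ), q'.2)) p'.1.2 q'.1.2]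

/-! ## §2  Condition (5.6) on an arbitrary `Ω ⊂ ℤ^d` (form sense) -/

/-- **Condition (5.6) for an arbitrary `Ω ⊂ ℤ^d`** (p. 594: *"Let Ω ⊂ Z^d and let A be a symmetric operator defined
on the space L²(Ω) … A ≥ γ₀I, |A(x,x′)| ≤ c₀e^{−δ₀|x−x′|}, x, x′ ∈ Ω. (5.6)"*), read for a KERNEL `A` on the ambient
index set: symmetry and the entry bound on `Ω`, and `A ≥ γ₀I` as a quadratic-form bound on finitely supported
vectors — i.e. B4's `Hyp56` for every finite `Λ ⊆ Ω` (for a finite `Ω` this is `B4.Hyp56 Ω A_Ω`, `of_hyp56` /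
`hyp56` below).  Values of `A` at indices outside `Ω` are never used. [cite: Balaban1983RegularityDecay, (5.6) p.594] -/
structure Hyp56Z (Ω : Set (Fin d → ℤ)) (A : K d N → K d N → ℝ) (γ₀ c₀ δ₀ : ℝ) : Prop where
  symm : ∀ p q : K d N, p.1 ∈ Ω → q.1 ∈ Ω → A p q = A q p
  coercive : ∀ Λ : Finset (Fin d → ℤ), (↑Λ : Set (Fin d → ℤ)) ⊆ Ω →
    ∀ v : B4.Idx Λ N → ℝ, γ₀ * ∑ p, v p ^ 2 ≤ ∑ p, v p * (toMat Λ A).mulVec v p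
  decay : ∀ p q : K d N, p.1 ∈ Ω → q.1 ∈ Ω → |A p q| ≤ c₀ * Real.exp (-(δ₀ * dist p.1 q.1))

namespace Hyp56Z

variable {Ω : Set (Fin d → ℤ)} {A : K d N → K d N → ℝ} {γ₀ c₀ δ₀ : ℝ}

/-- (5.6) passes to subsets. [folklore] -/
theorem mono (hA : Hyp56Z Ω A γ₀ c₀ δ₀) {Λ : Set (Fin d → ℤ)} (hΛ : Λ ⊆ Ω) : Hyp56Z Λ A γ₀ c₀ δ₀ where
  symm p q hp hq := hA.symm p q (hΛ hp) (hΛ hq)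
  coercive Λ' hΛ' := hA.coercive Λ' (hΛ'.trans hΛ)
  decay p q hp hq := hA.decay p q (hΛ hp) (hΛ hq)

/-- (5.6) on `Ω` gives B4's `Hyp56` for the matrix `A_Λ` of every finite `Λ ⊆ Ω`. [folklore] -/
theorem hyp56 (hA : Hyp56Z Ω A γ₀ c₀ δ₀) (Λ : Finset (Fin d → ℤ)) (hΛ : (↑Λ : Set (Fin d → ℤ)) ⊆ Ω) :
    B4.Hyp56 Λ (toMat Λ A) γ₀ c₀ δ₀ := by
  refine ⟨?_, hA.coercive Λ hΛ, fun p q => hA.decay _ _ (hΛ p.1.2) (hΛ q.1.2)⟩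
  exact Matrix.IsSymm.ext fun i j => hA.symm _ _ (hΛ j.1.2) (hΛ i.1.2)

end Hyp56Z

/-- For a FINITE `Ω`, B4's `Hyp56 Ω A_Ω` is (5.6) in the above sense (coercivity passes to compressions,
`B6GOmega.hyp56_compress`). [folklore] -/
theorem Hyp56Z.of_hyp56 {Ω : Finset (Fin d → ℤ)} {A : K d N → K d N → ℝ} {γ₀ c₀ δ₀ : ℝ} (hγ : 0 < γ₀)
    (hc : 0 ≤ c₀) (hδ : 0 ≤ δ₀) (hA : B4.Hyp56 Ω (toMat Ω A) γ₀ c₀ δ₀) :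
    Hyp56Z (↑Ω : Set (Fin d → ℤ)) A γ₀ c₀ δ₀ where
  symm p q hp hq := by
    have h := hA.1.apply (⟨q.1, hq⟩, q.2) (⟨p.1, hp⟩, p.2)
    exact h
  coercive Λ hΛ := by
    have hsub : Λ ⊆ Ω := fun x hx => by exact_mod_cast hΛ hx
    have h := (B6GOmega.hyp56_compress hsub hγ.le hc hδ hA).2.1
    rw [compress_toMat] at h
    exact h
  decay p q hp hq := hA.2.2 (⟨p.1, hp⟩, p.2) (⟨q.1, hq⟩, q.2)

/-! ## §3  Boxes, the canonical exhaustion `Ω ∩ [−n, n]^d`, and distances to points outside a box -/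

/-- The sup-norm cube `[−n, n]^d ∩ ℤ^d` of the exhaustion. [folklore] -/
noncomputable def cube (d n : ℕ) : Finset (Fin d → ℤ) := Fintype.piFinset fun _ => Finset.Icc (-(n : ℤ)) n

/-- Membership in the cube `[−n, n]^d`: all coordinates have absolute value `≤ n`. [folklore] -/
theorem mem_cube {n : ℕ} {x : Fin d → ℤ} : x ∈ cube d n ↔ ∀ i, |x i| ≤ n := by
  simp [cube, Fintype.mem_piFinset, abs_le]

/-- Cubes increase with the radius: a point of `[−n, n]^d` lies in `[−m, m]^d` for `n ≤ m`. [folklore] -/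
theorem mem_box_of_le {n m : ℕ} (h : n ≤ m) {x : Fin d → ℤ} (hx : x ∈ cube d n) : x ∈ cube d m := by
  rw [mem_cube] at hx ⊢
  exact fun i => (hx i).trans (by exact_mod_cast h)

/-- The sup-norm radius of a lattice point (a natural number). [folklore] -/
noncomputable def rad (x : Fin d → ℤ) : ℕ := Finset.univ.sup fun i => (x i).natAbs

/-- Every lattice point lies in the cube of its radius. [folklore] -/
theorem mem_box_rad (x : Fin d → ℤ) : x ∈ cube d (rad x) := by
  rw [mem_cube]
  intro i
  have h : (x i).natAbs ≤ rad x := Finset.le_sup (f := fun i => (x i).natAbs) (Finset.mem_univ i)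
  calc |x i| = ((x i).natAbs : ℤ) := (Int.natCast_natAbs (x i)).symm
    _ ≤ rad x := by exact_mod_cast h

/-- A point of radius `≤ n` lies in `[−n, n]^d`. [folklore] -/
theorem mem_box_of_rad_le {x : Fin d → ℤ} {n : ℕ} (h : rad x ≤ n) : x ∈ cube d n :=
  mem_box_of_le h (mem_box_rad x)

/-- The canonical exhaustion `Ω_n = Ω ∩ [−n, n]^d` of an arbitrary `Ω ⊂ ℤ^d` by finite sets. [folklore] -/
noncomputable def cut (Ω : Set (Fin d → ℤ)) (n : ℕ) : Finset (Fin d → ℤ) :=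
  (Set.Finite.inter_of_right (cube d n).finite_toSet Ω).toFinset

/-- Membership in the cut `Ω ∩ [−n, n]^d`. [folklore] -/
theorem mem_cut {Ω : Set (Fin d → ℤ)} {n : ℕ} {x : Fin d → ℤ} : x ∈ cut Ω n ↔ x ∈ Ω ∧ x ∈ cube d n := by
  simp [cut]

/-- The cuts lie inside `Ω`. [folklore] -/
theorem coe_cut_subset (Ω : Set (Fin d → ℤ)) (n : ℕ) : (↑(cut Ω n) : Set (Fin d → ℤ)) ⊆ Ω :=
  fun _ hx => (mem_cut.1 hx).1

/-- The cuts increase with `n`. [folklore] -/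
theorem cut_mono (Ω : Set (Fin d → ℤ)) {n m : ℕ} (h : n ≤ m) : cut Ω n ⊆ cut Ω m :=
  fun _ hx => mem_cut.2 ⟨(mem_cut.1 hx).1, mem_box_of_le h (mem_cut.1 hx).2⟩

/-- The cuts are monotone in the set. [folklore] -/
theorem cut_mono_set {Λ Ω : Set (Fin d → ℤ)} (h : Λ ⊆ Ω) (n : ℕ) : cut Λ n ⊆ cut Ω n :=
  fun _ hx => mem_cut.2 ⟨h (mem_cut.1 hx).1, (mem_cut.1 hx).2⟩

/-- A point of `Ω` of radius `≤ n` lies in the `n`-th cut. [folklore] -/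
theorem mem_cut_of_rad_le {Ω : Set (Fin d → ℤ)} {x : Fin d → ℤ} (hx : x ∈ Ω) {n : ℕ} (hn : rad x ≤ n) :
    x ∈ cut Ω n :=
  mem_cut.2 ⟨hx, mem_box_of_rad_le hn⟩

/-- A finite `Λ` is its own cut beyond its radius. [folklore] -/
theorem cut_coe_eq (Λ : Finset (Fin d → ℤ)) {n : ℕ} (hn : Λ.sup rad ≤ n) :
    cut (↑Λ : Set (Fin d → ℤ)) n = Λ := by
  ext x
  rw [mem_cut, Finset.mem_coe]
  constructor
  · exact fun h => h.1
  · intro hx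
    exact ⟨hx, mem_box_of_rad_le ((Finset.le_sup (f := rad) hx).trans hn)⟩

/-- **Points outside the box `[−n, n]^d` are far from points of `[−R, R]^d`**: `dist x y ≥ n + 1 − R` (sup metric).
[folklore] -/
theorem dist_ge_of_not_mem_box {R n : ℕ} {x y : Fin d → ℤ} (hx : x ∈ cube d R) (hy : y ∉ cube d n) :
    (n : ℝ) + 1 - R ≤ dist x y := by
  rw [mem_cube] at hx hy
  push Not at hy
  obtain ⟨i, hi⟩ := hy
  have hxi := hx i
  have h1 : dist (x i) (y i) ≤ dist x y := dist_le_pi_dist x y i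
  rw [Int.dist_eq] at h1
  have h2 : ((n : ℤ) : ℝ) + 1 ≤ |((y i : ℤ) : ℝ)| := by
    have : (n : ℤ) + 1 ≤ |y i| := by omega
    exact_mod_cast this
  have h3 : |((x i : ℤ) : ℝ)| ≤ (R : ℝ) := by exact_mod_cast hxi
  have h4 : |((y i : ℤ) : ℝ)| - |((x i : ℤ) : ℝ)| ≤ |((x i : ℤ) : ℝ) - (y i : ℝ)| := by
    rw [abs_sub_comm]; exact abs_sub_abs_le_abs_sub _ _
  push_cast at h2
  linarith

/-- The distance from a point of `[−R, R]^d` to a nonempty set avoiding `[−n, n]^d` is at least `n + 1 − R`.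
[folklore] -/
theorem le_infDist_of_disjoint_box {R n : ℕ} {x : Fin d → ℤ} (hx : x ∈ cube d R) {S : Set (Fin d → ℤ)}
    (hS : S.Nonempty) (hSn : ∀ y ∈ S, y ∉ cube d n) : (n : ℝ) + 1 - R ≤ Metric.infDist x S := by
  by_contra hlt
  have hlt' := lt_of_not_ge hlt
  obtain ⟨y, hy, hxy⟩ := (Metric.infDist_lt_iff hS).1 hlt'
  exact absurd hxy (not_lt.2 (dist_ge_of_not_mem_box hx (hSn y hy)))

/-! ## §4  Uniform lattice sums ⟹ summable majorants on the ambient index set -/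

/-- Finite partial sums of `e^{−a|x−y|}` over ambient indices are bounded by `N·K_d(a)` (`latticeSum_le`).
[folklore] -/
theorem sum_expKernel_le {a : ℝ} (ha : 0 < a) (x : Fin d → ℤ) (s : Finset (K d N)) :
    ∑ q ∈ s, Real.exp (-(a * dist x q.1)) ≤ N * latticeConst d a := by
  classical
  have hsub : s ⊆ (s.image Prod.fst) ×ˢ (Finset.univ : Finset (Fin N)) := by
    intro q hq
    exact Finset.mem_product.2 ⟨Finset.mem_image_of_mem _ hq, Finset.mem_univ _⟩
  calc ∑ q ∈ s, Real.exp (-(a * dist x q.1))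
      ≤ ∑ q ∈ (s.image Prod.fst) ×ˢ (Finset.univ : Finset (Fin N)), Real.exp (-(a * dist x q.1)) :=
        Finset.sum_le_sum_of_subset_of_nonneg hsub fun _ _ _ => (Real.exp_pos _).le
    _ = ∑ y ∈ s.image Prod.fst, (N : ℝ) * Real.exp (-(a * dist x y)) := by
        rw [Finset.sum_product]
        refine Finset.sum_congr rfl fun y _ => ?_
        simp
    _ = N * ∑ y ∈ s.image Prod.fst, Real.exp (-(a * dist x y)) := by rw [Finset.mul_sum]
    _ ≤ N * latticeConst d a :=
        mul_le_mul_of_nonneg_left (latticeSum_le d ha _ x) (Nat.cast_nonneg N)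

/-- `q ↦ e^{−a|x − q.1|}` is summable over the ambient index set, with sum `≤ N·K_d(a)`. [folklore] -/
theorem summable_expKernel {a : ℝ} (ha : 0 < a) (x : Fin d → ℤ) :
    Summable fun q : K d N => Real.exp (-(a * dist x q.1)) :=
  summable_of_sum_le (fun _ => (Real.exp_pos _).le) (sum_expKernel_le ha x)

/-- The total sum of `e^{−a|x − q.1|}` over ambient indices is `≤ N·K_d(a)`. [folklore] -/
theorem tsum_expKernel_le {a : ℝ} (ha : 0 < a) (x : Fin d → ℤ) :
    ∑' q : K d N, Real.exp (-(a * dist x q.1)) ≤ N * latticeConst d a :=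
  (summable_expKernel ha x).tsum_le_of_sum_le (sum_expKernel_le ha x)

/-! ## §5  The finite-volume inputs BY NAME (`B4Sect5Proof.sect5_explicit`): (5.7) and (5.8) with the uniform
constants `(cStar, deltaStar)` on every pair of finite sets `Λ ⊆ Ω' ⊆ Ω` -/

section Finite

variable {Ω : Set (Fin d → ℤ)} {A : K d N → K d N → ℝ} {γ₀ c₀ δ₀ : ℝ}

/-- **(5.7), uniformly on every finite `Λ ⊆ Ω`**: `|C_Λ(x,x′)| ≤ c⋆e^{−δ⋆|x−x′|}`. [cite: Balaban1983RegularityDecay, (5.7) p.594] -/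
theorem finInv_abs_le (hγ : 0 < γ₀) (hc : 0 < c₀) (hδ : 0 < δ₀) (hA : Hyp56Z Ω A γ₀ c₀ δ₀)
    (Λ : Finset (Fin d → ℤ)) (hΛ : (↑Λ : Set (Fin d → ℤ)) ⊆ Ω) (p q : K d N) :
    |finInv Λ A p q| ≤ cStar d N γ₀ c₀ δ₀ * Real.exp (-(deltaStar d N γ₀ c₀ δ₀ * dist p.1 q.1)) := by
  by_cases hp : p.1 ∈ Λ
  · by_cases hq : q.1 ∈ Λ
    · rw [finInv_of_mem A hp hq]
      have h := ((sect5_explicit d N hγ hc hδ Λ (toMat Λ A) (hA.hyp56 Λ hΛ)).1 Λ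
        (Finset.Subset.refl Λ)).1 (⟨p.1, hp⟩, p.2) (⟨q.1, hq⟩, q.2)
      exact h
    · rw [finInv_of_not_mem_right A hq, abs_zero]
      exact mul_nonneg (cStar_pos d N c₀ δ₀ hγ).le (Real.exp_pos _).le
  · rw [finInv_of_not_mem_left A hp, abs_zero]
    exact mul_nonneg (cStar_pos d N c₀ δ₀ hγ).le (Real.exp_pos _).le

/-- The cruder uniform bound `|C_Λ(x,x′)| ≤ c⋆`. [folklore] -/
theorem finInv_abs_le_cStar (hγ : 0 < γ₀) (hc : 0 < c₀) (hδ : 0 < δ₀) (hA : Hyp56Z Ω A γ₀ c₀ δ₀)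
    (Λ : Finset (Fin d → ℤ)) (hΛ : (↑Λ : Set (Fin d → ℤ)) ⊆ Ω) (p q : K d N) :
    |finInv Λ A p q| ≤ cStar d N γ₀ c₀ δ₀ := by
  refine (finInv_abs_le hγ hc hδ hA Λ hΛ p q).trans ?_
  have hc' := (cStar_pos d N c₀ δ₀ hγ).le
  have : Real.exp (-(deltaStar d N γ₀ c₀ δ₀ * dist p.1 q.1)) ≤ 1 := by
    rw [Real.exp_le_one_iff, neg_nonpos]
    exact mul_nonneg (deltaStar_pos d N hγ hc.le hδ).le dist_nonneg
  nlinarith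

/-- **(5.8), uniformly on every pair of finite sets `Λ ⊆ Ω' ⊆ Ω`**:
`|C_Λ(x,x′) − C_{Ω′}(x,x′)| ≤ c⋆e^{−δ⋆(|x−x′| + dist(x, Ω′∖Λ) + dist(x′, Ω′∖Λ))}` for `x, x′ ∈ Λ`. [cite: Balaban1983RegularityDecay, (5.8) p.594] -/
theorem finInv_sub_finInv_abs_le (hγ : 0 < γ₀) (hc : 0 < c₀) (hδ : 0 < δ₀) (hA : Hyp56Z Ω A γ₀ c₀ δ₀)
    {Λ Ω' : Finset (Fin d → ℤ)} (h : Λ ⊆ Ω') (hΩ' : (↑Ω' : Set (Fin d → ℤ)) ⊆ Ω) {p q : K d N}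
    (hp : p.1 ∈ Λ) (hq : q.1 ∈ Λ) :
    |finInv Λ A p q - finInv Ω' A p q| ≤ cStar d N γ₀ c₀ δ₀ *
      Real.exp (-(deltaStar d N γ₀ c₀ δ₀ * (dist p.1 q.1
        + Metric.infDist p.1 (↑(Ω' \ Λ) : Set (Fin d → ℤ))
        + Metric.infDist q.1 (↑(Ω' \ Λ) : Set (Fin d → ℤ))))) := by
  have hsec := ((sect5_explicit d N hγ hc hδ Ω' (toMat Ω' A) (hA.hyp56 Ω' hΩ')).1 Λ h).2
    (⟨p.1, hp⟩, p.2) (⟨q.1, hq⟩, q.2)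
  rw [finInv_of_mem A hp hq, finInv_of_mem A (h hp) (h hq)]
  exact hsec

end Finite

/-! ## §6  The entries of `C_{Ω_n}` along the exhaustion are Cauchy; the limit kernel `C_Ω` -/

section Limit

variable {Ω : Set (Fin d → ℤ)} {A : K d N → K d N → ℝ} {γ₀ c₀ δ₀ : ℝ}

/-- Quantitative Cauchy estimate along the exhaustion: for `R ≥` the radii of `x, x′` and `R ≤ n ≤ m`,
`|C_{Ω_n}(x,x′) − C_{Ω_m}(x,x′)| ≤ c⋆e^{−δ⋆(n + 1 − R)}` — every point of `Ω_m ∖ Ω_n` lies outside `[−n,n]^d`.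
[folklore] -/
theorem finInv_cut_dist_le (hγ : 0 < γ₀) (hc : 0 < c₀) (hδ : 0 < δ₀) (hA : Hyp56Z Ω A γ₀ c₀ δ₀)
    {p q : K d N} (hp : p.1 ∈ Ω) (hq : q.1 ∈ Ω) {R n m : ℕ} (hpR : rad p.1 ≤ R) (hqR : rad q.1 ≤ R)
    (hRn : R ≤ n) (hnm : n ≤ m) :
    |finInv (cut Ω n) A p q - finInv (cut Ω m) A p q| ≤
      cStar d N γ₀ c₀ δ₀ * Real.exp (-(deltaStar d N γ₀ c₀ δ₀ * ((n : ℝ) + 1 - R))) := by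
  have hpn : p.1 ∈ cut Ω n := mem_cut_of_rad_le hp (hpR.trans hRn)
  have hqn : q.1 ∈ cut Ω n := mem_cut_of_rad_le hq (hqR.trans hRn)
  have hsub : cut Ω n ⊆ cut Ω m := cut_mono Ω hnm
  by_cases hS : (↑(cut Ω m \ cut Ω n) : Set (Fin d → ℤ)).Nonempty
  · refine (finInv_sub_finInv_abs_le hγ hc hδ hA hsub (coe_cut_subset Ω m) hpn hqn).trans ?_
    refine mul_le_mul_of_nonneg_left ?_ (cStar_pos d N c₀ δ₀ hγ).le
    rw [Real.exp_le_exp, neg_le_neg_iff]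
    refine mul_le_mul_of_nonneg_left ?_ (deltaStar_pos d N hγ hc.le hδ).le
    have hout : ∀ y ∈ (↑(cut Ω m \ cut Ω n) : Set (Fin d → ℤ)), y ∉ cube d n := by
      intro y hy hyb
      rw [Finset.coe_sdiff] at hy
      have hym : y ∈ cut Ω m := hy.1
      exact hy.2 (mem_cut.2 ⟨(mem_cut.1 hym).1, hyb⟩)
    have h1 := le_infDist_of_disjoint_box (mem_box_of_rad_le hpR) hS hout
    have h2 : 0 ≤ Metric.infDist q.1 (↑(cut Ω m \ cut Ω n) : Set (Fin d → ℤ)) := Metric.infDist_nonneg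
    have h3 : 0 ≤ dist p.1 q.1 := dist_nonneg
    linarith
  · rw [Set.not_nonempty_iff_eq_empty, Finset.coe_eq_empty, Finset.sdiff_eq_empty_iff_subset] at hS
    have heq : cut Ω m = cut Ω n := Finset.Subset.antisymm hS hsub
    rw [heq, sub_self, abs_zero]
    exact mul_nonneg (cStar_pos d N c₀ δ₀ hγ).le (Real.exp_pos _).le

/-- `c·e^{−δ(n + 1 − R)} → 0`. [folklore] -/
theorem tendsto_const_mul_exp_neg {c δ : ℝ} (hδ : 0 < δ) (R : ℝ) :
    Tendsto (fun n : ℕ => c * Real.exp (-(δ * ((n : ℝ) + 1 - R)))) atTop (𝓝 0) := by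
  have h1 : Tendsto (fun n : ℕ => -(δ * ((n : ℝ) + 1 - R))) atTop atBot := by
    have h2 : Tendsto (fun n : ℕ => δ * ((n : ℝ) + 1 - R)) atTop atTop := by
      refine Tendsto.const_mul_atTop hδ ?_
      have h4 : Tendsto (fun n : ℕ => (n : ℝ) + (1 - R)) atTop atTop :=
        tendsto_atTop_add_const_right atTop (1 - R) tendsto_natCast_atTop_atTop
      exact h4.congr fun n => by ring
    exact tendsto_neg_atTop_atBot.comp h2
  have h3 := Real.tendsto_exp_atBot.comp h1
  simpa using h3.const_mul c

/-- **The entries of `C_{Ω_n}` are Cauchy sequences.** [folklore] -/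
theorem cauchySeq_finInv_cut (hγ : 0 < γ₀) (hc : 0 < c₀) (hδ : 0 < δ₀) (hA : Hyp56Z Ω A γ₀ c₀ δ₀)
    (p q : K d N) : CauchySeq fun n => finInv (cut Ω n) A p q := by
  by_cases hp : p.1 ∈ Ω
  · by_cases hq : q.1 ∈ Ω
    · set R : ℕ := max (rad p.1) (rad q.1) with hR
      set c := cStar d N γ₀ c₀ δ₀
      set δ := deltaStar d N γ₀ c₀ δ₀
      have hcpos : 0 < c := cStar_pos d N c₀ δ₀ hγ
      have hδpos : 0 < δ := deltaStar_pos d N hγ hc.le hδ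
      refine cauchySeq_of_le_tendsto_0' (fun n : ℕ => 2 * c * Real.exp (-(δ * ((n : ℝ) + 1 - R)))) ?_
        (tendsto_const_mul_exp_neg hδpos R)
      intro n m hnm
      rw [Real.dist_eq]
      by_cases hRn : R ≤ n
      · refine (finInv_cut_dist_le hγ hc hδ hA hp hq (le_max_left _ _) (le_max_right _ _) hRn hnm).trans ?_
        have := Real.exp_pos (-(δ * ((n : ℝ) + 1 - R)))
        nlinarith
      · have hRn := lt_of_not_ge hRn
        have hb1 := finInv_abs_le_cStar hγ hc hδ hA (cut Ω n) (coe_cut_subset Ω n) p q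
        have hb2 := finInv_abs_le_cStar hγ hc hδ hA (cut Ω m) (coe_cut_subset Ω m) p q
        have hexp : 1 ≤ Real.exp (-(δ * ((n : ℝ) + 1 - R))) := by
          rw [Real.one_le_exp_iff]
          have : (n : ℝ) + 1 ≤ R := by exact_mod_cast hRn
          nlinarith
        calc |finInv (cut Ω n) A p q - finInv (cut Ω m) A p q|
            ≤ |finInv (cut Ω n) A p q| + |finInv (cut Ω m) A p q| := abs_sub _ _
          _ ≤ c + c := add_le_add hb1 hb2
          _ = 2 * c * 1 := by ring
          _ ≤ 2 * c * Real.exp (-(δ * ((n : ℝ) + 1 - R))) :=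
              mul_le_mul_of_nonneg_left hexp (by positivity)
    · have : (fun n => finInv (cut Ω n) A p q) = fun _ => 0 :=
        funext fun n => finInv_of_not_mem_right A fun h => hq (coe_cut_subset Ω n h)
      rw [this]; exact cauchySeq_const 0
  · have : (fun n => finInv (cut Ω n) A p q) = fun _ => 0 :=
      funext fun n => finInv_of_not_mem_left A fun h => hp (coe_cut_subset Ω n h)
    rw [this]; exact cauchySeq_const 0

/-- **The infinite-volume inverse kernel `C_Ω := lim_n C_{Ω ∩ [−n,n]^d}`** (entrywise limit of the Dirichlet
compressions; for a finite `Ω` it is `A_Ω⁻¹`, `limInv_coe_finset`). [cite: Balaban1983RegularityDecay, Sect. 5 Theorem p.594] -/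
noncomputable def limInv (Ω : Set (Fin d → ℤ)) (A : K d N → K d N → ℝ) : K d N → K d N → ℝ :=
  fun p q => limUnder atTop fun n => finInv (cut Ω n) A p q

/-- The defining convergence `C_{Ω_n}(x,x′) → C_Ω(x,x′)`. [folklore] -/
theorem tendsto_limInv (hγ : 0 < γ₀) (hc : 0 < c₀) (hδ : 0 < δ₀) (hA : Hyp56Z Ω A γ₀ c₀ δ₀) (p q : K d N) :
    Tendsto (fun n => finInv (cut Ω n) A p q) atTop (𝓝 (limInv Ω A p q)) :=
  tendsto_nhds_limUnder (cauchySeq_tendsto_of_complete (cauchySeq_finInv_cut hγ hc hδ hA p q))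

/-- `C_Ω` vanishes off `Ω × Ω`. [folklore] -/
theorem limInv_of_not_mem (hγ : 0 < γ₀) (hc : 0 < c₀) (hδ : 0 < δ₀) (hA : Hyp56Z Ω A γ₀ c₀ δ₀) {p q : K d N}
    (h : p.1 ∉ Ω ∨ q.1 ∉ Ω) : limInv Ω A p q = 0 := by
  have hzero : ∀ n, finInv (cut Ω n) A p q = 0 := by
    intro n
    rcases h with hp | hq
    · exact finInv_of_not_mem_left A fun h' => hp (coe_cut_subset Ω n h')
    · exact finInv_of_not_mem_right A fun h' => hq (coe_cut_subset Ω n h')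
  have h1 := tendsto_limInv hγ hc hδ hA p q
  simp_rw [hzero] at h1
  exact (tendsto_nhds_unique h1 tendsto_const_nhds)

/-- For a FINITE `Ω` the limit kernel is the zero-extended `A_Ω⁻¹` itself (the exhaustion is eventually constant).
[folklore] -/
theorem limInv_coe_finset (hγ : 0 < γ₀) (hc : 0 < c₀) (hδ : 0 < δ₀) (Λ : Finset (Fin d → ℤ))
    (hA : Hyp56Z (↑Λ : Set (Fin d → ℤ)) A γ₀ c₀ δ₀) (p q : K d N) :
    limInv (↑Λ : Set (Fin d → ℤ)) A p q = finInv Λ A p q := by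
  have h1 := tendsto_limInv hγ hc hδ hA p q
  have h2 : Tendsto (fun n => finInv (cut (↑Λ : Set (Fin d → ℤ)) n) A p q) atTop (𝓝 (finInv Λ A p q)) := by
    refine tendsto_const_nhds.congr' ?_
    rw [EventuallyEq, eventually_atTop]
    exact ⟨Λ.sup rad, fun n hn => by rw [cut_coe_eq Λ hn]⟩
  exact tendsto_nhds_unique h1 h2

/-- **(5.7) for the infinite-volume kernel**, same constants: `|C_Ω(x,x′)| ≤ c⋆e^{−δ⋆|x−x′|}`. [cite: Balaban1983RegularityDecay, (5.7) p.594] -/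
theorem limInv_abs_le (hγ : 0 < γ₀) (hc : 0 < c₀) (hδ : 0 < δ₀) (hA : Hyp56Z Ω A γ₀ c₀ δ₀) (p q : K d N) :
    |limInv Ω A p q| ≤ cStar d N γ₀ c₀ δ₀ * Real.exp (-(deltaStar d N γ₀ c₀ δ₀ * dist p.1 q.1)) :=
  le_of_tendsto' (tendsto_limInv hγ hc hδ hA p q).abs fun n =>
    finInv_abs_le hγ hc hδ hA (cut Ω n) (coe_cut_subset Ω n) p q

/-- `A_Λ⁻¹` is symmetric for a symmetric `A`. [folklore] -/
theorem finInv_symm {Λ : Finset (Fin d → ℤ)} (hΛ : (↑Λ : Set (Fin d → ℤ)) ⊆ Ω) (hA : Hyp56Z Ω A γ₀ c₀ δ₀)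
    (p q : K d N) : finInv Λ A p q = finInv Λ A q p := by
  by_cases hp : p.1 ∈ Λ
  · by_cases hq : q.1 ∈ Λ
    · rw [finInv_of_mem A hp hq, finInv_of_mem A hq hp]
      have hsymm : (toMat Λ A).IsSymm := (hA.hyp56 Λ hΛ).1
      have h1 : ((toMat Λ A)⁻¹)ᵀ = (toMat Λ A)⁻¹ := by
        rw [Matrix.transpose_nonsing_inv, hsymm.eq]
      have h2 := congrFun (congrFun h1 (⟨q.1, hq⟩, q.2)) (⟨p.1, hp⟩, p.2)
      rw [Matrix.transpose_apply] at h2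
      exact h2
    · rw [finInv_of_not_mem_right A hq, finInv_of_not_mem_left A hq]
  · rw [finInv_of_not_mem_left A hp, finInv_of_not_mem_right A hp]

/-- **`C_Ω` is symmetric.** [folklore] -/
theorem limInv_symm (hγ : 0 < γ₀) (hc : 0 < c₀) (hδ : 0 < δ₀) (hA : Hyp56Z Ω A γ₀ c₀ δ₀) (p q : K d N) :
    limInv Ω A p q = limInv Ω A q p := by
  have h1 := tendsto_limInv hγ hc hδ hA p q
  have h2 := tendsto_limInv hγ hc hδ hA q p
  simp_rw [finInv_symm (coe_cut_subset Ω _) hA p q] at h1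
  exact tendsto_nhds_unique h1 h2

end Limit

/-! ## §7  (5.8) in infinite volume: `|C_Λ − C_Ω| ≤ c⋆e^{−δ⋆(|x−x′| + dist(x, Ω∖Λ) + dist(x′, Ω∖Λ))}` for
EVERY pair `Λ ⊆ Ω ⊂ ℤ^d` (finite or not), same constants -/

section DeltaC

variable {Ω : Set (Fin d → ℤ)} {A : K d N → K d N → ℝ} {γ₀ c₀ δ₀ : ℝ}

/-- (5.8) along the two exhaustions `Λ_n ⊆ Ω_n`: the points of `Ω_n ∖ Λ_n` lie in `Ω ∖ Λ`. [folklore] -/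
theorem finInv_cut_sub_cut_abs_le (hγ : 0 < γ₀) (hc : 0 < c₀) (hδ : 0 < δ₀) (hA : Hyp56Z Ω A γ₀ c₀ δ₀)
    {Λ : Set (Fin d → ℤ)} (hΛ : Λ ⊆ Ω) {p q : K d N} (hp : p.1 ∈ Λ) (hq : q.1 ∈ Λ) {n : ℕ}
    (hpn : rad p.1 ≤ n) (hqn : rad q.1 ≤ n) :
    |finInv (cut Λ n) A p q - finInv (cut Ω n) A p q| ≤ cStar d N γ₀ c₀ δ₀ *
      Real.exp (-(deltaStar d N γ₀ c₀ δ₀ *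
        (dist p.1 q.1 + Metric.infDist p.1 (Ω \ Λ) + Metric.infDist q.1 (Ω \ Λ)))) := by
  have hsub : cut Λ n ⊆ cut Ω n := cut_mono_set hΛ n
  have hpn' : p.1 ∈ cut Λ n := mem_cut_of_rad_le hp hpn
  have hqn' : q.1 ∈ cut Λ n := mem_cut_of_rad_le hq hqn
  by_cases hS : (↑(cut Ω n \ cut Λ n) : Set (Fin d → ℤ)).Nonempty
  · refine (finInv_sub_finInv_abs_le hγ hc hδ hA hsub (coe_cut_subset Ω n) hpn' hqn').trans ?_
    refine mul_le_mul_of_nonneg_left ?_ (cStar_pos d N c₀ δ₀ hγ).le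
    rw [Real.exp_le_exp, neg_le_neg_iff]
    refine mul_le_mul_of_nonneg_left ?_ (deltaStar_pos d N hγ hc.le hδ).le
    have hSsub : (↑(cut Ω n \ cut Λ n) : Set (Fin d → ℤ)) ⊆ Ω \ Λ := by
      intro y hy
      rw [Finset.coe_sdiff] at hy
      have hyΩ : y ∈ cut Ω n := hy.1
      refine ⟨(mem_cut.1 hyΩ).1, fun hyΛ => hy.2 ?_⟩
      exact (mem_cut.2 ⟨hyΛ, (mem_cut.1 hyΩ).2⟩ : y ∈ cut Λ n)
    have h1 := Metric.infDist_le_infDist_of_subset hSsub hS (x := p.1)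
    have h2 := Metric.infDist_le_infDist_of_subset hSsub hS (x := q.1)
    linarith
  · rw [Set.not_nonempty_iff_eq_empty, Finset.coe_eq_empty, Finset.sdiff_eq_empty_iff_subset] at hS
    have heq : cut Ω n = cut Λ n := Finset.Subset.antisymm hS hsub
    rw [heq, sub_self, abs_zero]
    exact mul_nonneg (cStar_pos d N c₀ δ₀ hγ).le (Real.exp_pos _).le

/-- **(5.8) for every pair `Λ ⊆ Ω ⊂ ℤ^d`, finite or infinite, with the SAME constants `(c⋆, δ⋆)`**:
`|C_Λ(x,x′) − C_Ω(x,x′)| ≤ c⋆e^{−δ⋆(|x−x′| + dist(x, Ω∖Λ) + dist(x′, Ω∖Λ))}`, `x, x′ ∈ Λ` (p. 594 (5.8), p. 596: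
*"Λᶜ [the complement] of Λ in Ω"*). [cite: Balaban1983RegularityDecay, (5.8) p.594] -/
theorem limInv_sub_limInv_abs_le (hγ : 0 < γ₀) (hc : 0 < c₀) (hδ : 0 < δ₀) (hA : Hyp56Z Ω A γ₀ c₀ δ₀)
    {Λ : Set (Fin d → ℤ)} (hΛ : Λ ⊆ Ω) {p q : K d N} (hp : p.1 ∈ Λ) (hq : q.1 ∈ Λ) :
    |limInv Λ A p q - limInv Ω A p q| ≤ cStar d N γ₀ c₀ δ₀ *
      Real.exp (-(deltaStar d N γ₀ c₀ δ₀ *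
        (dist p.1 q.1 + Metric.infDist p.1 (Ω \ Λ) + Metric.infDist q.1 (Ω \ Λ)))) := by
  have h1 := tendsto_limInv hγ hc hδ (hA.mono hΛ) p q
  have h2 := tendsto_limInv hγ hc hδ hA p q
  refine le_of_tendsto (h1.sub h2).abs (eventually_atTop.2 ⟨max (rad p.1) (rad q.1), fun n hn => ?_⟩)
  exact finInv_cut_sub_cut_abs_le hγ hc hδ hA hΛ hp hq ((le_max_left _ _).trans hn)
    ((le_max_right _ _).trans hn)

/-- **(5.8) for a FINITE `Λ` inside an arbitrary `Ω`**, in B4's literal objects: the matrix entries of `A_Λ⁻¹` versus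
the infinite-volume kernel `C_Ω`. [cite: Balaban1983RegularityDecay, (5.8) p.594] -/
theorem inv_toMat_sub_limInv_abs_le (hγ : 0 < γ₀) (hc : 0 < c₀) (hδ : 0 < δ₀) (hA : Hyp56Z Ω A γ₀ c₀ δ₀)
    (Λ : Finset (Fin d → ℤ)) (hΛ : (↑Λ : Set (Fin d → ℤ)) ⊆ Ω) (p' q' : B4.Idx Λ N) :
    |(toMat Λ A)⁻¹ p' q' - limInv Ω A ((p'.1 : Fin d → ℤ), p'.2) ((q'.1 : Fin d → ℤ), q'.2)| ≤
      cStar d N γ₀ c₀ δ₀ * Real.exp (-(deltaStar d N γ₀ c₀ δ₀ *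
        (dist (p'.1 : Fin d → ℤ) (q'.1 : Fin d → ℤ)
          + Metric.infDist (p'.1 : Fin d → ℤ) (Ω \ ↑Λ) + Metric.infDist (q'.1 : Fin d → ℤ) (Ω \ ↑Λ)))) := by
  rw [inv_toMat_apply, ← limInv_coe_finset hγ hc hδ Λ (hA.mono hΛ)]
  exact limInv_sub_limInv_abs_le hγ hc hδ hA hΛ p'.1.2 q'.1.2

/-- **Exhaustion independence / convergence of arbitrary finite-volume inverses**: for finite `Λ ⊆ Ω` containing
`x, x′`, `|C_Λ(x,x′) − C_Ω(x,x′)| ≤ c⋆e^{−δ⋆·dist(x, Ω∖Λ)}` — so `C_Λ(x,x′) → C_Ω(x,x′)` along ANY family of finite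
sets that eventually swallows every bounded part of `Ω`, not only along cubes. [folklore] -/
theorem finInv_sub_limInv_abs_le (hγ : 0 < γ₀) (hc : 0 < c₀) (hδ : 0 < δ₀) (hA : Hyp56Z Ω A γ₀ c₀ δ₀)
    (Λ : Finset (Fin d → ℤ)) (hΛ : (↑Λ : Set (Fin d → ℤ)) ⊆ Ω) {p q : K d N} (hp : p.1 ∈ Λ) (hq : q.1 ∈ Λ) :
    |finInv Λ A p q - limInv Ω A p q| ≤
      cStar d N γ₀ c₀ δ₀ * Real.exp (-(deltaStar d N γ₀ c₀ δ₀ * Metric.infDist p.1 (Ω \ ↑Λ))) := by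
  rw [← limInv_coe_finset hγ hc hδ Λ (hA.mono hΛ)]
  refine (limInv_sub_limInv_abs_le hγ hc hδ hA hΛ (p := p) (q := q) hp hq).trans ?_
  refine mul_le_mul_of_nonneg_left ?_ (cStar_pos d N c₀ δ₀ hγ).le
  rw [Real.exp_le_exp, neg_le_neg_iff]
  refine mul_le_mul_of_nonneg_left ?_ (deltaStar_pos d N hγ hc.le hδ).le
  have h1 : 0 ≤ dist p.1 q.1 := dist_nonneg
  have h2 : 0 ≤ Metric.infDist q.1 (Ω \ ↑Λ) := Metric.infDist_nonneg
  linarith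

end DeltaC

/-! ## §8  `C_Ω` IS the inverse of `A` on `Ω`: `Σ_y A(x,y)C_Ω(y,x′) = δ_{xx′} = Σ_y C_Ω(x,y)A(y,x′)` with absolutely
convergent sums (Tannery's theorem along the exhaustion) -/

section Inverse

variable {Ω : Set (Fin d → ℤ)} {A : K d N → K d N → ℝ} {γ₀ c₀ δ₀ : ℝ}

/-- The finite identity `A_Λ A_Λ⁻¹ = I` read on ambient indices: for `x, x′ ∈ Λ`,
`Σ_y A(x,y)C_Λ(y,x′) = δ_{xx′}` (the sum is finite: `C_Λ` vanishes off `Λ`). [folklore] -/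
theorem tsum_mul_finInv (hγ : 0 < γ₀) (hA : Hyp56Z Ω A γ₀ c₀ δ₀) (Λ : Finset (Fin d → ℤ))
    (hΛ : (↑Λ : Set (Fin d → ℤ)) ⊆ Ω) {p r : K d N} (hp : p.1 ∈ Λ) (hr : r.1 ∈ Λ) :
    ∑' q, A p q * finInv Λ A q r = if p = r then 1 else 0 := by
  classical
  set M := toMat Λ A with hM
  set p' : B4.Idx Λ N := (⟨p.1, hp⟩, p.2) with hp'
  set r' : B4.Idx Λ N := (⟨r.1, hr⟩, r.2) with hr'
  have hdet : IsUnit M.det :=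
    (Matrix.isUnit_iff_isUnit_det M).1 (B4Sect5Proof.isUnit_of_hyp56 hγ (hA.hyp56 Λ hΛ))
  have hiff : p' = r' ↔ p = r := by
    constructor
    · intro h
      have h1 : (p'.1 : Fin d → ℤ) = (r'.1 : Fin d → ℤ) := by rw [h]
      have h2 : p'.2 = r'.2 := by rw [h]
      exact Prod.ext h1 h2
    · rintro rfl; rfl
  have key : ∑ q' : B4.Idx Λ N, M p' q' * M⁻¹ q' r' = if p = r then 1 else 0 := by
    rw [← Matrix.mul_apply, Matrix.mul_nonsing_inv M hdet, Matrix.one_apply]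
    by_cases hpr : p = r
    · rw [if_pos hpr, if_pos (hiff.2 hpr)]
    · rw [if_neg hpr, if_neg (fun h => hpr (hiff.1 h))]
  have hzero : ∀ q ∉ Λ ×ˢ (Finset.univ : Finset (Fin N)), A p q * finInv Λ A q r = 0 := by
    intro q hq
    have hq1 : q.1 ∉ Λ := fun h => hq (Finset.mem_product.2 ⟨h, Finset.mem_univ _⟩)
    rw [finInv_of_not_mem_left A hq1, mul_zero]
  calc ∑' q, A p q * finInv Λ A q r
      = ∑ q ∈ Λ ×ˢ (Finset.univ : Finset (Fin N)), A p q * finInv Λ A q r := tsum_eq_sum hzero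
    _ = ∑ y ∈ Λ, ∑ i : Fin N, A p (y, i) * finInv Λ A (y, i) r := Finset.sum_product _ _ _
    _ = ∑ y : ↥Λ, ∑ i : Fin N, A p ((y : Fin d → ℤ), i) * finInv Λ A ((y : Fin d → ℤ), i) r :=
        (Finset.sum_coe_sort Λ _).symm
    _ = ∑ y : ↥Λ, ∑ i : Fin N, M p' (y, i) * M⁻¹ (y, i) r' := by
        refine Finset.sum_congr rfl fun y _ => Finset.sum_congr rfl fun i _ => ?_
        rw [finInv_of_mem A (p := ((y : Fin d → ℤ), i)) (q := r) y.2 hr]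
        rfl
    _ = ∑ q' : B4.Idx Λ N, M p' q' * M⁻¹ q' r' :=
        (Fintype.sum_prod_type (f := fun q' : B4.Idx Λ N => M p' q' * M⁻¹ q' r')).symm
    _ = if p = r then 1 else 0 := key

/-- The Tannery majorant: `|A(x,y)C_{Ω_n}(y,x′)| ≤ c₀c⋆e^{−δ₀|x−y|}`, summable in `y`. [folklore] -/
theorem abs_mul_finInv_le (hγ : 0 < γ₀) (hc : 0 < c₀) (hδ : 0 < δ₀) (hA : Hyp56Z Ω A γ₀ c₀ δ₀)
    {p : K d N} (hp : p.1 ∈ Ω) (n : ℕ) (q r : K d N) :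
    |A p q * finInv (cut Ω n) A q r| ≤ c₀ * cStar d N γ₀ c₀ δ₀ * Real.exp (-(δ₀ * dist p.1 q.1)) := by
  by_cases hq : q.1 ∈ Ω
  · rw [abs_mul]
    have h1 := hA.decay p q hp hq
    have h2 := finInv_abs_le_cStar hγ hc hδ hA (cut Ω n) (coe_cut_subset Ω n) q r
    calc |A p q| * |finInv (cut Ω n) A q r|
        ≤ (c₀ * Real.exp (-(δ₀ * dist p.1 q.1))) * cStar d N γ₀ c₀ δ₀ :=
          mul_le_mul h1 h2 (abs_nonneg _) (by positivity)
      _ = c₀ * cStar d N γ₀ c₀ δ₀ * Real.exp (-(δ₀ * dist p.1 q.1)) := by ring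
  · rw [finInv_of_not_mem_left A (fun h => hq (coe_cut_subset Ω n h)), mul_zero, abs_zero]
    have := cStar_pos d N c₀ δ₀ hγ
    positivity

/-- **Right inverse**: for `x, x′ ∈ Ω`, `Σ_y A(x,y)C_Ω(y,x′) = δ_{xx′}` — Tannery's theorem
(`tendsto_tsum_of_dominated_convergence`) on the eventually constant sequence of finite identities.
[cite: Balaban1983RegularityDecay, Sect. 5 Theorem p.594] -/
theorem tsum_mul_limInv (hγ : 0 < γ₀) (hc : 0 < c₀) (hδ : 0 < δ₀) (hA : Hyp56Z Ω A γ₀ c₀ δ₀)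
    {p r : K d N} (hp : p.1 ∈ Ω) (hr : r.1 ∈ Ω) :
    ∑' q, A p q * limInv Ω A q r = if p = r then 1 else 0 := by
  have h_sum : Summable fun q : K d N => c₀ * cStar d N γ₀ c₀ δ₀ * Real.exp (-(δ₀ * dist p.1 q.1)) :=
    (summable_expKernel hδ p.1).mul_left _
  have hab : ∀ q : K d N, Tendsto (fun n => A p q * finInv (cut Ω n) A q r) atTop
      (𝓝 (A p q * limInv Ω A q r)) :=
    fun q => (tendsto_limInv hγ hc hδ hA q r).const_mul (A p q)
  have h_bound : ∀ᶠ n : ℕ in atTop, ∀ q : K d N,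
      ‖A p q * finInv (cut Ω n) A q r‖ ≤ c₀ * cStar d N γ₀ c₀ δ₀ * Real.exp (-(δ₀ * dist p.1 q.1)) :=
    Eventually.of_forall fun n q => by
      rw [Real.norm_eq_abs]; exact abs_mul_finInv_le hγ hc hδ hA hp n q r
  have hlim := tendsto_tsum_of_dominated_convergence
    (f := fun n q => A p q * finInv (cut Ω n) A q r) (g := fun q => A p q * limInv Ω A q r) h_sum hab h_bound
  have hconst : ∀ᶠ n : ℕ in atTop,
      (if p = r then (1 : ℝ) else 0) = ∑' q, A p q * finInv (cut Ω n) A q r :=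
    eventually_atTop.2 ⟨max (rad p.1) (rad r.1), fun n hn =>
      (tsum_mul_finInv hγ hA (cut Ω n) (coe_cut_subset Ω n)
        (mem_cut_of_rad_le hp ((le_max_left _ _).trans hn))
        (mem_cut_of_rad_le hr ((le_max_right _ _).trans hn))).symm⟩
  have hlim2 : Tendsto (fun n => ∑' q, A p q * finInv (cut Ω n) A q r) atTop
      (𝓝 (if p = r then (1 : ℝ) else 0)) :=
    tendsto_const_nhds.congr' hconst
  exact tendsto_nhds_unique hlim hlim2

/-- The row sums `Σ_y A(x,y)C_Ω(y,x′)` converge absolutely. [folklore] -/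
theorem summable_mul_limInv (hγ : 0 < γ₀) (hc : 0 < c₀) (hδ : 0 < δ₀) (hA : Hyp56Z Ω A γ₀ c₀ δ₀)
    {p : K d N} (hp : p.1 ∈ Ω) (r : K d N) : Summable fun q => A p q * limInv Ω A q r := by
  refine Summable.of_norm_bounded ((summable_expKernel hδ p.1).mul_left (c₀ * cStar d N γ₀ c₀ δ₀))
    fun q => ?_
  rw [Real.norm_eq_abs]
  refine le_of_tendsto ((tendsto_limInv hγ hc hδ hA q r).const_mul (A p q)).abs
    (Eventually.of_forall fun n => ?_)
  exact abs_mul_finInv_le hγ hc hδ hA hp n q r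

/-- **Left inverse**: for `x, x′ ∈ Ω`, `Σ_y C_Ω(x,y)A(y,x′) = δ_{xx′}` (from the right inverse by the symmetry of
`A` and of `C_Ω`). [cite: Balaban1983RegularityDecay, Sect. 5 Theorem p.594] -/
theorem tsum_limInv_mul (hγ : 0 < γ₀) (hc : 0 < c₀) (hδ : 0 < δ₀) (hA : Hyp56Z Ω A γ₀ c₀ δ₀)
    {p r : K d N} (hp : p.1 ∈ Ω) (hr : r.1 ∈ Ω) :
    ∑' q, limInv Ω A p q * A q r = if p = r then 1 else 0 := by
  have h := tsum_mul_limInv hγ hc hδ hA hr hp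
  have hterm : ∀ q : K d N, limInv Ω A p q * A q r = A r q * limInv Ω A q p := by
    intro q
    by_cases hq : q.1 ∈ Ω
    · rw [limInv_symm hγ hc hδ hA p q, hA.symm q r hq hr, mul_comm]
    · rw [limInv_of_not_mem hγ hc hδ hA (Or.inr hq), limInv_of_not_mem hγ hc hδ hA (Or.inl hq),
        zero_mul, mul_zero]
  simp_rw [hterm, h]
  by_cases hpr : p = r
  · rw [if_pos hpr, if_pos hpr.symm]
  · rw [if_neg hpr, if_neg (Ne.symm hpr)]

/-- The column sums converge absolutely as well. [folklore] -/
theorem summable_limInv_mul (hγ : 0 < γ₀) (hc : 0 < c₀) (hδ : 0 < δ₀) (hA : Hyp56Z Ω A γ₀ c₀ δ₀)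
    (p : K d N) {r : K d N} (hr : r.1 ∈ Ω) : Summable fun q => limInv Ω A p q * A q r := by
  have h := summable_mul_limInv hγ hc hδ hA hr p
  refine h.congr fun q => ?_
  by_cases hq : q.1 ∈ Ω
  · rw [limInv_symm hγ hc hδ hA p q, hA.symm q r hq hr, mul_comm]
  · rw [limInv_of_not_mem hγ hc hδ hA (Or.inr hq), limInv_of_not_mem hγ hc hδ hA (Or.inl hq),
      zero_mul, mul_zero]

end Inverse

/-! ## §9  Uniqueness: `C_Ω` is THE bounded inverse kernel of `A` on `Ω` -/

section Unique

variable {Ω : Set (Fin d → ℤ)} {A : K d N → K d N → ℝ} {γ₀ c₀ δ₀ : ℝ}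

/-- Finite partial sums of the Fubini majorant `e^{−a|q−r|}e^{−b|r−s|}` over pairs of ambient indices are
bounded by `(N·K_d(a))(N·K_d(b))`. [folklore] -/
theorem sum_expKernel2_le {a b : ℝ} (ha : 0 < a) (hb : 0 < b) (z : Fin d → ℤ) (S : Finset (K d N × K d N)) :
    ∑ x ∈ S, Real.exp (-(a * dist x.1.1 x.2.1)) * Real.exp (-(b * dist z x.2.1)) ≤
      (N * latticeConst d a) * (N * latticeConst d b) := by
  classical
  have hsub : S ⊆ (S.image Prod.fst) ×ˢ (S.image Prod.snd) := by
    intro x hx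
    exact Finset.mem_product.2 ⟨Finset.mem_image_of_mem _ hx, Finset.mem_image_of_mem _ hx⟩
  have hNK : 0 ≤ (N : ℝ) * latticeConst d a :=
    mul_nonneg (Nat.cast_nonneg N) (B4Sect5Proof.latticeConst_nonneg d ha.le)
  calc ∑ x ∈ S, Real.exp (-(a * dist x.1.1 x.2.1)) * Real.exp (-(b * dist z x.2.1))
      ≤ ∑ x ∈ (S.image Prod.fst) ×ˢ (S.image Prod.snd),
          Real.exp (-(a * dist x.1.1 x.2.1)) * Real.exp (-(b * dist z x.2.1)) :=
        Finset.sum_le_sum_of_subset_of_nonneg hsub fun _ _ _ => by positivity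
    _ = ∑ r ∈ S.image Prod.snd, Real.exp (-(b * dist z r.1)) *
          ∑ q ∈ S.image Prod.fst, Real.exp (-(a * dist r.1 q.1)) := by
        rw [Finset.sum_product_right]
        refine Finset.sum_congr rfl fun r _ => ?_
        rw [Finset.mul_sum]
        refine Finset.sum_congr rfl fun q _ => ?_
        rw [dist_comm q.1 r.1]; ring
    _ ≤ ∑ r ∈ S.image Prod.snd, Real.exp (-(b * dist z r.1)) * (N * latticeConst d a) := by
        refine Finset.sum_le_sum fun r _ => ?_
        exact mul_le_mul_of_nonneg_left (sum_expKernel_le ha r.1 _) (Real.exp_pos _).le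
    _ = (N * latticeConst d a) * ∑ r ∈ S.image Prod.snd, Real.exp (-(b * dist z r.1)) := by
        rw [← Finset.sum_mul, mul_comm]
    _ ≤ (N * latticeConst d a) * (N * latticeConst d b) :=
        mul_le_mul_of_nonneg_left (sum_expKernel_le hb z _) hNK

/-- **Uniqueness of the inverse kernel.**  Let `D` be an entrywise-bounded kernel, vanishing when its second index
lies outside `Ω`, with `Σ_y D(x,y)A(y,x′) = δ_{xx′}` for `x, x′ ∈ Ω`.  Then `D = C_Ω` on `Ω × Ω`.  (Fubini over the
absolutely summable triple product `D(x,y)A(y,z)C_Ω(z,x′)`.)  Hence "`A_Ω⁻¹`" for an infinite `Ω` has exactly one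
meaning among bounded kernels, and it is the exhaustion limit. [folklore] -/
theorem eq_limInv_of_left_inverse (hγ : 0 < γ₀) (hc : 0 < c₀) (hδ : 0 < δ₀) (hA : Hyp56Z Ω A γ₀ c₀ δ₀)
    {D : K d N → K d N → ℝ} {M : ℝ} (hDM : ∀ p q, |D p q| ≤ M) (hD0 : ∀ p q : K d N, q.1 ∉ Ω → D p q = 0)
    (hDA : ∀ p r : K d N, p.1 ∈ Ω → r.1 ∈ Ω → ∑' q, D p q * A q r = if p = r then 1 else 0)
    {p s : K d N} (hp : p.1 ∈ Ω) (hs : s.1 ∈ Ω) : D p s = limInv Ω A p s := by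
  set C := limInv Ω A with hC
  set c := cStar d N γ₀ c₀ δ₀
  set δ := deltaStar d N γ₀ c₀ δ₀
  have hcpos : 0 < c := cStar_pos d N c₀ δ₀ hγ
  have hδpos : 0 < δ := deltaStar_pos d N hγ hc.le hδ
  have hM : 0 ≤ M := (abs_nonneg _).trans (hDM p p)
  -- the triple product and its majorant
  set f : K d N → K d N → ℝ := fun q r => D p q * A q r * C r s with hf
  set F : K d N × K d N → ℝ := fun x =>
    M * c₀ * c * (Real.exp (-(δ₀ * dist x.1.1 x.2.1)) * Real.exp (-(δ * dist s.1 x.2.1))) with hF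
  have hFsum : Summable F := by
    refine summable_of_sum_le (fun x => by positivity) (c := M * c₀ * c *
      ((N * latticeConst d δ₀) * (N * latticeConst d δ))) fun S => ?_
    rw [← Finset.mul_sum]
    exact mul_le_mul_of_nonneg_left (sum_expKernel2_le hδ hδpos s.1 S) (by positivity)
  have hfF : ∀ x : K d N × K d N, ‖Function.uncurry f x‖ ≤ F x := by
    rintro ⟨q, r⟩
    rw [Real.norm_eq_abs, Function.uncurry_apply_pair]
    by_cases hq : q.1 ∈ Ω
    · by_cases hr : r.1 ∈ Ω
      · have h1 := hDM p q
        have h2 := hA.decay q r hq hr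
        have h3 := limInv_abs_le hγ hc hδ hA r s
        rw [dist_comm r.1 s.1] at h3
        calc |D p q * A q r * C r s| = |D p q| * |A q r| * |C r s| := by rw [abs_mul, abs_mul]
          _ ≤ M * (c₀ * Real.exp (-(δ₀ * dist q.1 r.1))) * (c * Real.exp (-(δ * dist s.1 r.1))) := by
              refine mul_le_mul (mul_le_mul h1 h2 (abs_nonneg _) hM) h3 (abs_nonneg _) ?_
              positivity
          _ = F (q, r) := by simp only [hF]; ring
      · have : C r s = 0 := limInv_of_not_mem hγ hc hδ hA (Or.inl hr)
        show |D p q * A q r * C r s| ≤ F (q, r)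
        rw [this, mul_zero, abs_zero]; positivity
    · show |D p q * A q r * C r s| ≤ F (q, r)
      rw [hD0 p q hq, zero_mul, zero_mul, abs_zero]; positivity
  have hfsum : Summable (Function.uncurry f) := hFsum.of_norm_bounded hfF
  -- Fubini
  have hcomm : ∑' r, ∑' q, f q r = ∑' q, ∑' r, f q r := hfsum.tsum_comm
  -- assemble
  have step1 : D p s = ∑' q, D p q * ∑' r, A q r * C r s := by
    rw [tsum_eq_single s (f := fun q => D p q * ∑' r, A q r * C r s) ?_]
    · rw [tsum_mul_limInv hγ hc hδ hA hs hs, if_pos rfl, mul_one]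
    · intro q hqs
      by_cases hq : q.1 ∈ Ω
      · rw [tsum_mul_limInv hγ hc hδ hA hq hs, if_neg hqs, mul_zero]
      · rw [hD0 p q hq, zero_mul]
  have step2 : (∑' q, D p q * ∑' r, A q r * C r s) = ∑' q, ∑' r, f q r := by
    refine tsum_congr fun q => ?_
    rw [← tsum_mul_left]
    refine tsum_congr fun r => ?_
    simp only [hf]; ring
  have step3 : (∑' r, ∑' q, f q r) = ∑' r, (∑' q, D p q * A q r) * C r s := by
    refine tsum_congr fun r => ?_
    rw [← tsum_mul_right]
  have step4 : (∑' r, (∑' q, D p q * A q r) * C r s) = C p s := by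
    rw [tsum_eq_single p (f := fun r => (∑' q, D p q * A q r) * C r s) ?_]
    · rw [hDA p p hp hp, if_pos rfl, one_mul]
    · intro r hrp
      by_cases hr : r.1 ∈ Ω
      · rw [hDA p r hp hr, if_neg (Ne.symm hrp), zero_mul]
      · rw [show C r s = 0 from limInv_of_not_mem hγ hc hδ hA (Or.inl hr), mul_zero]
  rw [step1, step2, ← hcomm, step3, step4]

/-- Symmetric form: a bounded kernel vanishing when its FIRST index lies outside `Ω` with `A D = 1` on `Ω` is `C_Ω`.
[folklore] -/
theorem eq_limInv_of_right_inverse (hγ : 0 < γ₀) (hc : 0 < c₀) (hδ : 0 < δ₀) (hA : Hyp56Z Ω A γ₀ c₀ δ₀)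
    {D : K d N → K d N → ℝ} {M : ℝ} (hDM : ∀ p q, |D p q| ≤ M) (hD0 : ∀ p q : K d N, p.1 ∉ Ω → D p q = 0)
    (hAD : ∀ p r : K d N, p.1 ∈ Ω → r.1 ∈ Ω → ∑' q, A p q * D q r = if p = r then 1 else 0)
    {p s : K d N} (hp : p.1 ∈ Ω) (hs : s.1 ∈ Ω) : D p s = limInv Ω A p s := by
  -- apply the left-inverse form to the transposed kernel
  have h := eq_limInv_of_left_inverse hγ hc hδ hA (D := fun p q => D q p) (M := M)
    (fun p q => hDM q p) (fun p q hq => hD0 q p hq) ?_ hs hp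
  · rw [h]; exact limInv_symm hγ hc hδ hA s p
  · intro p r hp' hr'
    have h1 := hAD r p hr' hp'
    have hterm : ∀ q : K d N, D q p * A q r = A r q * D q p := by
      intro q
      by_cases hq : q.1 ∈ Ω
      · rw [hA.symm q r hq hr', mul_comm]
      · rw [hD0 q p hq, zero_mul, mul_zero]
    simp_rw [hterm, h1]
    by_cases hpr : p = r
    · rw [if_pos hpr, if_pos hpr.symm]
    · rw [if_neg hpr, if_neg (Ne.symm hpr)]

end Unique

/-! ## §10  The perturbation statement (5.9) ⟹ (5.10) in infinite volume -/

section Perturbation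

variable {Ω : Set (Fin d → ℤ)} {A B : K d N → K d N → ℝ} {γ₀ c₀ δ₀ : ℝ}

/-- **Condition (5.9) for a kernel `B` on an arbitrary `Ω ⊂ ℤ^d`** (p. 594, verbatim: *"|B(x,x′)| ≤
c₀e^{−δ₀(|x−x′| + dist(x,Ωᶜ) + dist(x′,Ωᶜ))}, x, x′ ∈ Ω (5.9)"*; `Ωᶜ` = the complement in `ℤ^d`, as in B4's `Hyp59`).
[cite: Balaban1983RegularityDecay, (5.9) p.594] -/
def Hyp59Z (Ω : Set (Fin d → ℤ)) (B : K d N → K d N → ℝ) (c₀ δ₀ : ℝ) : Prop :=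
  ∀ p q : K d N, p.1 ∈ Ω → q.1 ∈ Ω → |B p q| ≤
    c₀ * Real.exp (-(δ₀ * (dist p.1 q.1 + Metric.infDist p.1 Ωᶜ + Metric.infDist q.1 Ωᶜ)))

/-- Distances to complements shrink along `Ω' ⊆ Ω ≠ ℤ^d`: `dist(x, Ω'ᶜ) ≤ dist(x, Ωᶜ)`.  (Mathlib's `infDist x ∅ = 0`,
whereas the printed `dist(x, ∅)` is `+∞`; hence the hypothesis `Ωᶜ ≠ ∅`, see the header's DICTIONARY.) [folklore] -/
theorem infDist_compl_le_of_subset (hΩc : (Ωᶜ : Set (Fin d → ℤ)).Nonempty) {Ω' : Set (Fin d → ℤ)} (h : Ω' ⊆ Ω)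
    (x : Fin d → ℤ) : Metric.infDist x Ω'ᶜ ≤ Metric.infDist x Ωᶜ :=
  Metric.infDist_le_infDist_of_subset (Set.compl_subset_compl.2 h) hΩc

/-- (5.9) on `Ω ≠ ℤ^d` gives B4's `Hyp59` for the matrix `B_{Ω'}` of every finite `Ω' ⊆ Ω`. [folklore] -/
theorem Hyp59Z.hyp59 (hB : Hyp59Z Ω B c₀ δ₀) (hΩc : (Ωᶜ : Set (Fin d → ℤ)).Nonempty) (hc : 0 ≤ c₀)
    (hδ : 0 ≤ δ₀) (Ω' : Finset (Fin d → ℤ)) (hΩ' : (↑Ω' : Set (Fin d → ℤ)) ⊆ Ω) :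
    B4.Hyp59 Ω' (toMat Ω' B) c₀ δ₀ := by
  intro p q
  refine (hB _ _ (hΩ' p.1.2) (hΩ' q.1.2)).trans ?_
  refine mul_le_mul_of_nonneg_left ?_ hc
  rw [Real.exp_le_exp, neg_le_neg_iff]
  refine mul_le_mul_of_nonneg_left ?_ hδ
  have h1 := infDist_compl_le_of_subset hΩc hΩ' (p.1 : Fin d → ℤ)
  have h2 := infDist_compl_le_of_subset hΩc hΩ' (q.1 : Fin d → ℤ)
  show dist (p.1 : Fin d → ℤ) (q.1 : Fin d → ℤ) + Metric.infDist (p.1 : Fin d → ℤ) (↑Ω' : Set (Fin d → ℤ))ᶜ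
      + Metric.infDist (q.1 : Fin d → ℤ) (↑Ω' : Set (Fin d → ℤ))ᶜ ≤
    dist (p.1 : Fin d → ℤ) (q.1 : Fin d → ℤ) + Metric.infDist (p.1 : Fin d → ℤ) Ωᶜ
      + Metric.infDist (q.1 : Fin d → ℤ) Ωᶜ
  linarith

/-- Along the exhaustion the complement of `Ω_n` is `Ωᶜ ∪ (Ω ∖ [−n,n]^d)`, so for `x ∈ [−R,R]^d`:
`min(dist(x, Ωᶜ), n + 1 − R) ≤ dist(x, Ω_nᶜ)`. [folklore] -/
theorem min_le_infDist_compl_cut {x : Fin d → ℤ} {R : ℕ} (hx : rad x ≤ R) (n : ℕ) :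
    min (Metric.infDist x Ωᶜ) ((n : ℝ) + 1 - R) ≤ Metric.infDist x (↑(cut Ω n) : Set (Fin d → ℤ))ᶜ := by
  by_cases hS : ((↑(cut Ω n) : Set (Fin d → ℤ))ᶜ).Nonempty
  · by_contra hlt
    have hlt' := lt_of_not_ge hlt
    obtain ⟨y, hy, hxy⟩ := (Metric.infDist_lt_iff hS).1 hlt'
    rw [Set.mem_compl_iff, Finset.mem_coe] at hy
    by_cases hyΩ : y ∈ Ω
    · have hyb : y ∉ cube d n := fun hb => hy (mem_cut.2 ⟨hyΩ, hb⟩)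
      have h1 := dist_ge_of_not_mem_box (mem_box_of_rad_le hx) hyb
      exact absurd hxy (not_lt.2 ((min_le_right _ _).trans h1))
    · have h1 := Metric.infDist_le_dist_of_mem (x := x) (Set.mem_compl hyΩ)
      exact absurd hxy (not_lt.2 ((min_le_left _ _).trans h1))
  · rw [Set.not_nonempty_iff_eq_empty] at hS
    have hΩc : (Ωᶜ : Set (Fin d → ℤ)) = ∅ := by
      apply Set.eq_empty_of_subset_empty
      rw [← hS]
      exact Set.compl_subset_compl.2 (coe_cut_subset Ω n)
    rw [hS, hΩc, Metric.infDist_empty]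
    exact min_le_left _ _

/-- (5.10) at level `n` of the exhaustion, from B4's finite-volume (5.10) on `Λ_n ⊆ Ω_n` BY NAME. [folklore] -/
theorem finInv_cut_perturb_abs_le (hγ : 0 < γ₀) (hc : 0 < c₀) (hδ : 0 < δ₀) (hA : Hyp56Z Ω A γ₀ c₀ δ₀)
    (hAB : Hyp56Z Ω (A + B) γ₀ c₀ δ₀) (hB : Hyp59Z Ω B c₀ δ₀) (hΩc : (Ωᶜ : Set (Fin d → ℤ)).Nonempty)
    {Λ : Set (Fin d → ℤ)} (hΛ : Λ ⊆ Ω)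
    {p q : K d N} (hp : p.1 ∈ Λ) (hq : q.1 ∈ Λ) {n : ℕ} (hpn : rad p.1 ≤ n) (hqn : rad q.1 ≤ n) :
    |finInv (cut Λ n) A p q - finInv (cut Λ n) (A + B) p q| ≤ cStar d N γ₀ c₀ δ₀ *
      Real.exp (-(deltaStar d N γ₀ c₀ δ₀ * (dist p.1 q.1
        + Metric.infDist p.1 (↑(cut Ω n) : Set (Fin d → ℤ))ᶜ
        + Metric.infDist q.1 (↑(cut Ω n) : Set (Fin d → ℤ))ᶜ))) := by
  have hsub : cut Λ n ⊆ cut Ω n := cut_mono_set hΛ n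
  have hpn' : p.1 ∈ cut Λ n := mem_cut_of_rad_le hp hpn
  have hqn' : q.1 ∈ cut Λ n := mem_cut_of_rad_le hq hqn
  have h510 := (sect5_explicit d N hγ hc hδ (cut Ω n) (toMat (cut Ω n) A)
    (hA.hyp56 (cut Ω n) (coe_cut_subset Ω n))).2 (toMat (cut Ω n) B)
    (hAB.hyp56 (cut Ω n) (coe_cut_subset Ω n)) (hB.hyp59 hΩc hc.le hδ.le (cut Ω n) (coe_cut_subset Ω n))
    (cut Λ n) hsub (⟨p.1, hpn'⟩, p.2) (⟨q.1, hqn'⟩, q.2)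
  rw [finInv_of_mem A hpn' hqn', finInv_of_mem (A + B) hpn' hqn']
  exact h510

/-- **(5.10) for every pair `Λ ⊆ Ω ⊊ ℤ^d`, finite or infinite, same constants**: if `A` and `A + B` satisfy (5.6) on
`Ω` and `B` satisfies (5.9), then `|C_Λ[A](x,x′) − C_Λ[A+B](x,x′)| ≤ c⋆e^{−δ⋆(|x−x′| + dist(x,Ωᶜ) + dist(x′,Ωᶜ))}`,
`x, x′ ∈ Λ`.  (`Ω ≠ ℤ^d`: for `Ω = ℤ^d` the printed (5.9), with `dist(x, ∅) = +∞`, forces `B = 0` and (5.10) is void —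
header DICTIONARY (δ).) [cite: Balaban1983RegularityDecay, (5.10) p.594] -/
theorem limInv_perturb_abs_le (hγ : 0 < γ₀) (hc : 0 < c₀) (hδ : 0 < δ₀) (hA : Hyp56Z Ω A γ₀ c₀ δ₀)
    (hAB : Hyp56Z Ω (A + B) γ₀ c₀ δ₀) (hB : Hyp59Z Ω B c₀ δ₀) (hΩc : (Ωᶜ : Set (Fin d → ℤ)).Nonempty)
    {Λ : Set (Fin d → ℤ)} (hΛ : Λ ⊆ Ω) {p q : K d N} (hp : p.1 ∈ Λ) (hq : q.1 ∈ Λ) :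
    |limInv Λ A p q - limInv Λ (A + B) p q| ≤ cStar d N γ₀ c₀ δ₀ *
      Real.exp (-(deltaStar d N γ₀ c₀ δ₀ *
        (dist p.1 q.1 + Metric.infDist p.1 Ωᶜ + Metric.infDist q.1 Ωᶜ))) := by
  have h1 := tendsto_limInv hγ hc hδ (hA.mono hΛ) p q
  have h2 := tendsto_limInv hγ hc hδ (hAB.mono hΛ) p q
  set R : ℕ := max (rad p.1) (rad q.1) with hR
  set n₀ : ℕ := R + ⌈Metric.infDist p.1 Ωᶜ⌉₊ + ⌈Metric.infDist q.1 Ωᶜ⌉₊ with hn₀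
  refine le_of_tendsto (h1.sub h2).abs (eventually_atTop.2 ⟨n₀, fun n hn => ?_⟩)
  have hRn : R ≤ n := by omega
  refine (finInv_cut_perturb_abs_le hγ hc hδ hA hAB hB hΩc hΛ hp hq ((le_max_left _ _).trans hRn)
    ((le_max_right _ _).trans hRn)).trans ?_
  refine mul_le_mul_of_nonneg_left ?_ (cStar_pos d N c₀ δ₀ hγ).le
  rw [Real.exp_le_exp, neg_le_neg_iff]
  refine mul_le_mul_of_nonneg_left ?_ (deltaStar_pos d N hγ hc.le hδ).le
  have hp1 := min_le_infDist_compl_cut (Ω := Ω) (le_max_left (rad p.1) (rad q.1)) n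
  have hq1 := min_le_infDist_compl_cut (Ω := Ω) (le_max_right (rad p.1) (rad q.1)) n
  have hcast : (n₀ : ℝ) ≤ n := by exact_mod_cast hn
  have hn₀' : (n₀ : ℝ) = R + ⌈Metric.infDist p.1 Ωᶜ⌉₊ + ⌈Metric.infDist q.1 Ωᶜ⌉₊ := by
    simp [hn₀]
  have hcp := Nat.le_ceil (Metric.infDist p.1 Ωᶜ)
  have hcq := Nat.le_ceil (Metric.infDist q.1 Ωᶜ)
  have h0p : 0 ≤ Metric.infDist p.1 Ωᶜ := Metric.infDist_nonneg
  have h0q : 0 ≤ Metric.infDist q.1 Ωᶜ := Metric.infDist_nonneg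
  have hminp : min (Metric.infDist p.1 Ωᶜ) ((n : ℝ) + 1 - R) = Metric.infDist p.1 Ωᶜ :=
    min_eq_left (by linarith)
  have hminq : min (Metric.infDist q.1 Ωᶜ) ((n : ℝ) + 1 - R) = Metric.infDist q.1 Ωᶜ :=
    min_eq_left (by linarith)
  rw [hminp] at hp1
  rw [hminq] at hq1
  linarith

end Perturbation

/-! ## §11  The Sect. 5 Theorem of B4 for an ARBITRARY `Ω ⊂ ℤ^d`, packaged -/

/-- **Sect. 5 Theorem of B4 (CMP 89 (1983) p. 594) for an ARBITRARY — possibly infinite — `Ω ⊂ ℤ^d`, UNIFORM reading**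
(constants `c₁, δ₁` depending on `γ₀, c₀, δ₀, d, N` only, as p. 597 closes: *"The constants δ₁, c₁ are functions of
δ₀, γ₀, c₀"*).  For every `Ω ⊂ ℤ^d` and every kernel `A` with (5.6) on `Ω`, and every `Λ ⊆ Ω`, the kernel
`C_Λ := limInv Λ A` (the entrywise limit of the Dirichlet compressions `A_{Λ ∩ [−n,n]^d}⁻¹`; `= A_Λ⁻¹` for finite `Λ`)
is a two-sided inverse of `A_Λ = ΛAΛ` with absolutely convergent sums, vanishes off `Λ × Λ`, and satisfies (5.7),
(5.8) (`δC_Λ = C_Λ − C_Ω`, `Λᶜ` = complement of `Λ` in `Ω`, p. 596), and — for `Ω ≠ ℤ^d`, under (5.6) for `A + B`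
and (5.9) for `B` — (5.10) (for `Ω = ℤ^d` the printed (5.9) forces `B = 0`, header DICTIONARY (δ)).  By
`eq_limInv_of_left_inverse` it is moreover the ONLY bounded inverse kernel.
[cite: Balaban1983RegularityDecay, Sect. 5 Theorem (5.6)–(5.10) p.594 + p.597] -/
def Sect5ThmSetOmega (d N : ℕ) : Prop :=
  ∀ γ₀ c₀ δ₀ : ℝ, 0 < γ₀ → 0 < c₀ → 0 < δ₀ → ∃ c₁ δ₁ : ℝ, 0 < c₁ ∧ 0 < δ₁ ∧
    ∀ (Ω : Set (Fin d → ℤ)) (A : K d N → K d N → ℝ), Hyp56Z Ω A γ₀ c₀ δ₀ →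
      (∀ Λ : Set (Fin d → ℤ), Λ ⊆ Ω →
        (∀ p r : K d N, p.1 ∈ Λ → r.1 ∈ Λ →
          ∑' q, A p q * limInv Λ A q r = if p = r then 1 else 0) ∧
        (∀ p r : K d N, p.1 ∈ Λ → r.1 ∈ Λ →
          ∑' q, limInv Λ A p q * A q r = if p = r then 1 else 0) ∧
        (∀ p q : K d N, (p.1 ∉ Λ ∨ q.1 ∉ Λ) → limInv Λ A p q = 0) ∧
        (∀ p q : K d N, |limInv Λ A p q| ≤ c₁ * Real.exp (-(δ₁ * dist p.1 q.1))) ∧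
        (∀ p q : K d N, p.1 ∈ Λ → q.1 ∈ Λ → |limInv Λ A p q - limInv Ω A p q| ≤
          c₁ * Real.exp (-(δ₁ * (dist p.1 q.1
            + Metric.infDist p.1 (Ω \ Λ) + Metric.infDist q.1 (Ω \ Λ)))))) ∧
      (Ωᶜ.Nonempty → ∀ B : K d N → K d N → ℝ, Hyp56Z Ω (A + B) γ₀ c₀ δ₀ → Hyp59Z Ω B c₀ δ₀ →
        ∀ Λ : Set (Fin d → ℤ), Λ ⊆ Ω → ∀ p q : K d N, p.1 ∈ Λ → q.1 ∈ Λ →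
          |limInv Λ A p q - limInv Λ (A + B) p q| ≤
            c₁ * Real.exp (-(δ₁ * (dist p.1 q.1 + Metric.infDist p.1 Ωᶜ + Metric.infDist q.1 Ωᶜ))))

/-- **The Sect. 5 Theorem of B4 holds for arbitrary `Ω ⊂ ℤ^d`**, with the explicit constants
`(cStar, deltaStar)` of `B4Sect5Proof`. [cite: Balaban1983RegularityDecay, Sect. 5 Theorem p.594] -/
theorem sect5ThmSetOmega_holds (d N : ℕ) : Sect5ThmSetOmega d N := by
  intro γ₀ c₀ δ₀ hγ hc hδ
  refine ⟨cStar d N γ₀ c₀ δ₀, deltaStar d N γ₀ c₀ δ₀, cStar_pos d N c₀ δ₀ hγ,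
    deltaStar_pos d N hγ hc.le hδ, fun Ω A hA => ⟨fun Λ hΛ => ⟨?_, ?_, ?_, ?_, ?_⟩, ?_⟩⟩
  · exact fun p r hp hr => tsum_mul_limInv hγ hc hδ (hA.mono hΛ) hp hr
  · exact fun p r hp hr => tsum_limInv_mul hγ hc hδ (hA.mono hΛ) hp hr
  · exact fun p q h => limInv_of_not_mem hγ hc hδ (hA.mono hΛ) h
  · exact fun p q => limInv_abs_le hγ hc hδ (hA.mono hΛ) p q
  · exact fun p q hp hq => limInv_sub_limInv_abs_le hγ hc hδ hA hΛ hp hq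
  · exact fun hΩc B hAB hB Λ hΛ p q hp hq => limInv_perturb_abs_le hγ hc hδ hA hAB hB hΩc hΛ hp hq

/-- Non-vacuity of the hypothesis class on an INFINITE `Ω`: the identity kernel on `Ω = ℤ^d` satisfies (5.6) with
`γ₀ = c₀ = δ₀ = 1`. [folklore] -/
theorem hyp56Z_one (d N : ℕ) :
    Hyp56Z (Set.univ : Set (Fin d → ℤ)) (fun p q : K d N => if p = q then (1 : ℝ) else 0) 1 1 1 := by
  classical
  refine ⟨fun p q _ _ => ?_, fun Λ _ v => ?_, fun p q _ _ => ?_⟩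
  · by_cases h : p = q
    · subst h; rfl
    · rw [if_neg h, if_neg (Ne.symm h)]
  · have hmv : ∀ p : B4.Idx Λ N, (toMat Λ fun p q : K d N => if p = q then (1 : ℝ) else 0).mulVec v p = v p := by
      intro p
      have hone : (toMat Λ fun p q : K d N => if p = q then (1 : ℝ) else 0) = 1 := by
        ext a b
        simp only [toMat, Matrix.one_apply]
        by_cases hab : a = b
        · subst hab; simp
        · have : ((a.1 : Fin d → ℤ), a.2) ≠ ((b.1 : Fin d → ℤ), b.2) := by
            intro h
            apply hab
            have h1 : (a.1 : Fin d → ℤ) = (b.1 : Fin d → ℤ) := (Prod.ext_iff.1 h).1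
            have h2 : a.2 = b.2 := (Prod.ext_iff.1 h).2
            exact Prod.ext (Subtype.ext h1) h2
          rw [if_neg this, if_neg hab]
      rw [hone, Matrix.one_mulVec]
    simp_rw [hmv, one_mul, pow_two]
    exact le_rfl
  · by_cases h : p = q
    · subst h; simp
    · rw [if_neg h, abs_zero]; positivity



end Literature.MathematicalPhysics.QuantumFieldTheory.Balaban1983to89.B4Sect5Exhaustion
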